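import Mathlib
import Summits.QuantumAdvantage.QuantumAdvantage.Theorems.CubicForrelationExactPairsMaioranaMcFarlandDillonNormalForm

/-!
# `QuadraticDigitPhases` (stmt-QuantumAdvantage-1391), line `Sketch` — lemmas for the stub `stub_orbitGauss`

Gauss-sum estimates on the cosets of a subgroup of the elementary abelian `2`-group
`V = Fin r → ZMod 2`, for the `±1`-valued function `u ↦ (-1)^(Q u)` attached to a map
`Q : V → ZMod 2` of degree `≤ 2` (all third differences vanish and `Q 0 = 0`), whose polar form
`β u v = Q (u + v) + Q u + Q v` is then biadditive and symmetric.  The subgroup is a decidable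
predicate `p` on `V` containing `0` and closed under `+` (closure under negation is automatic in
characteristic two); a coset of it is a predicate `f` with `f u ↔ p (u + u₀)`.  Everything is stated
without auxiliary definitions: the polar form is a function `β` with its defining hypothesis `hβ`.

* `sum_sgn_pol`: the character sum `∑_{b ∈ K} (-1)^{β b w}` equals `|K|` if `β w · ≡ 0` on `K`
  and `0` otherwise (pair `b ↔ b + v₁` with `β w v₁ = 1`);
* `gauss_sq`: `(∑_{u ∈ u₀ + K} (-1)^{Q u})² = |K| · ∑_{w ∈ Rad K} (-1)^{Q (u₀ + w) + Q u₀}` with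
  `Rad K = {w ∈ K | β w · ≡ 0 on K}`, whence `gauss_sq_le`: `S² ≤ |K| · |Rad K|`;
* `gauss_eq_zero`: `S = 0` as soon as some `u₁ ∈ K` has `β u₁ · ≡ 0` on all of `V` and `Q u₁ ≠ 0`
  (pair `u ↔ u + u₁`);
* `fibre_bound`: `|S| ≤ |u₀ + K| · sqrt (|Rad K| / |K|) · 1[∀ u ∈ K, β u · ≡ 0 on V → Q u = 0]`
  (with the polar form written out).

Elementary (Gauss sums of quadratic forms over `𝔽₂`, folklore); Mathlib only, plus the sign rule
`dnf_chi_add` (`(-1)^(a+b) = (-1)^a (-1)^b` on `ZMod 2`) reused from the tree.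
-/

set_option linter.dupNamespace false -- D-0017: single-problem summit ⇒ `QuantumAdvantage.QuantumAdvantage` by design

namespace Summit.QuantumAdvantage.QuantumAdvantage.Theorems.MobiusLadderQuadraticDigitPhasesStubOrbitGaussLemmas

open Finset
open Summit.QuantumAdvantage.QuantumAdvantage.Theorems.CubicForrelation.ExactPairsMaioranaMcFarland
  (dnf_chi_add)

/-! ### Signs `(-1)^(a.val)` for `a : ZMod 2` -/

/-- `(-1)^a = -1` for `a ≠ 0` in `ZMod 2`. -/
theorem sgn_of_ne_zero {a : ZMod 2} (h : a ≠ 0) : (-1 : ℝ) ^ a.val = -1 := by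
  have key : ∀ b : ZMod 2, b ≠ 0 → b.val = 1 := by decide
  rw [key a h, pow_one]

/-- `|(-1)^a| = 1`. -/
theorem abs_sgn (a : ZMod 2) : |(-1 : ℝ) ^ a.val| = 1 := by
  rw [abs_pow, abs_neg, abs_one, one_pow]

/-! ### The elementary abelian group `Fin r → ZMod 2` -/

variable {r : ℕ}

/-- Characteristic two: `u + u = 0`. -/
theorem add_self (u : Fin r → ZMod 2) : u + u = 0 := by
  funext i
  exact CharTwo.add_self_eq_zero (u i)

/-- `u + v + v = u`. -/
theorem add_add_cancel (u v : Fin r → ZMod 2) : u + v + v = u := by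
  rw [add_assoc, add_self, add_zero]

/-- `v + (v + u) = u`. -/
theorem add_add_cancel_left (u v : Fin r → ZMod 2) : v + (v + u) = u := by
  rw [← add_assoc, add_self, zero_add]

/-- `|Fin r → ZMod 2| = 2 ^ r`. -/
theorem card_fun_zmod_two : Fintype.card (Fin r → ZMod 2) = 2 ^ r := by
  rw [Fintype.card_fun, ZMod.card, Fintype.card_fin]

/-! ### Maps of degree at most two and their polar forms -/

section DegTwo

variable (Q : (Fin r → ZMod 2) → ZMod 2) (β : (Fin r → ZMod 2) → (Fin r → ZMod 2) → ZMod 2)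
  (hβ : ∀ u v, β u v = Q (u + v) + Q u + Q v)
include hβ

/-- The polar form is symmetric. -/
theorem pol_comm (u v : Fin r → ZMod 2) : β u v = β v u := by
  rw [hβ, hβ, add_comm u v]
  ring

/-- `Q (u + v) = β u v + Q u + Q v` (characteristic two). -/
theorem eq_pol_add (u v : Fin r → ZMod 2) : Q (u + v) = β u v + Q u + Q v := by
  rw [hβ]
  have key : ∀ x a b : ZMod 2, x = x + a + b + a + b := by decide
  exact key _ _ _

/-- `β 0 w = 0` when `Q 0 = 0`. -/
theorem pol_zero_left (hQ0 : Q 0 = 0) (w : Fin r → ZMod 2) : β 0 w = 0 := by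
  rw [hβ, zero_add, hQ0, add_zero, CharTwo.add_self_eq_zero]

omit hβ in
/-- Arithmetic in `ZMod 2` behind `pol_add_left`. -/
theorem deg_aux₁ : ∀ a b c d e f g : ZMod 2, a + b + c + d + e + f + g = 0 →
    a + b + g = c + e + g + (d + f + g) := by
  decide

omit hβ in
/-- Arithmetic in `ZMod 2` behind `gauss_identity`. -/
theorem deg_aux₂ : ∀ a b c d e f g : ZMod 2, a + b + c + d + e + f + g = 0 →
    a + b = c + e + (d + f + g) := by
  decide

variable (hdeg : ∀ u v w : Fin r → ZMod 2,
  Q (u + v + w) + Q (u + v) + Q (u + w) + Q (v + w) + Q u + Q v + Q w = 0)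
include hdeg

/-- Degree `≤ 2`: the polar form is additive in its first argument. -/
theorem pol_add_left (u v w : Fin r → ZMod 2) : β (u + v) w = β u w + β v w := by
  simp only [hβ]
  exact deg_aux₁ _ _ _ _ _ _ _ (hdeg u v w)

/-- Degree `≤ 2`: the second difference along a coset, `Q (u₀ + (b + w)) + Q (u₀ + b)
= Q (u₀ + w) + Q u₀ + β b w`. -/
theorem gauss_identity (u₀ b w : Fin r → ZMod 2) :
    Q (u₀ + (b + w)) + Q (u₀ + b) = Q (u₀ + w) + Q u₀ + β b w := by
  rw [hβ, ← add_assoc]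
  exact deg_aux₂ _ _ _ _ _ _ _ (hdeg u₀ b w)

end DegTwo

/-! ### Subgroups (as predicates), cosets, character sums -/

section Subgroup

variable (p : (Fin r → ZMod 2) → Prop) [DecidablePred p] (Q : (Fin r → ZMod 2) → ZMod 2)
  (β : (Fin r → ZMod 2) → (Fin r → ZMod 2) → ZMod 2)

/-- Sum over a subgroup, re-indexed by a translation inside the subgroup. -/
theorem sum_shift (hpadd : ∀ u v, p u → p v → p (u + v)) {b : Fin r → ZMod 2} (hb : p b)
    (g : (Fin r → ZMod 2) → ℝ) :
    ∑ a ∈ univ.filter p, g a = ∑ w ∈ univ.filter p, g (b + w) := by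
  symm
  refine Finset.sum_equiv (Equiv.addLeft b) ?_ ?_
  · intro w
    simp only [mem_filter, mem_univ, true_and, Equiv.coe_addLeft]
    constructor
    · exact hpadd _ _ hb
    · intro h
      have := hpadd _ _ hb h
      rwa [add_add_cancel_left] at this
  · intro w _
    rfl

/-- Sum over a coset `{u | p (u + u₀)}`, re-indexed over the subgroup. -/
theorem sum_fibre (u₀ : Fin r → ZMod 2) (f : (Fin r → ZMod 2) → Prop) [DecidablePred f]
    (hf : ∀ u, f u ↔ p (u + u₀)) (g : (Fin r → ZMod 2) → ℝ) :
    ∑ u ∈ univ.filter f, g u = ∑ k ∈ univ.filter p, g (u₀ + k) := by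
  symm
  refine Finset.sum_equiv (Equiv.addLeft u₀) ?_ ?_
  · intro k
    simp only [mem_filter, mem_univ, true_and, Equiv.coe_addLeft, hf]
    rw [add_comm u₀ k, add_add_cancel]
  · intro k _
    rfl

/-- A coset has as many elements as the subgroup. -/
theorem card_fibre (u₀ : Fin r → ZMod 2) (f : (Fin r → ZMod 2) → Prop) [DecidablePred f]
    (hf : ∀ u, f u ↔ p (u + u₀)) : (univ.filter f).card = (univ.filter p).card := by
  have h := sum_fibre p u₀ f hf (fun _ => (1 : ℝ))
  simp only [Finset.sum_const, nsmul_eq_mul, mul_one] at h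
  exact_mod_cast h

/-- **Character sum over a subgroup.** For `w` fixed, `∑_{b ∈ K} (-1)^{β b w}` is `|K|` if
`β w ·` vanishes on `K` and `0` otherwise. -/
theorem sum_sgn_pol (hpadd : ∀ u v, p u → p v → p (u + v)) (hQ0 : Q 0 = 0)
    (hβ : ∀ u v, β u v = Q (u + v) + Q u + Q v)
    (hdeg : ∀ u v w : Fin r → ZMod 2,
      Q (u + v + w) + Q (u + v) + Q (u + w) + Q (v + w) + Q u + Q v + Q w = 0)
    (w : Fin r → ZMod 2) :
    ∑ b ∈ univ.filter p, (-1 : ℝ) ^ (β b w).val =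
      if (∀ v, p v → β w v = 0) then ((univ.filter p).card : ℝ) else 0 := by
  split_ifs with h
  · have h1 : ∀ b ∈ univ.filter p, (-1 : ℝ) ^ (β b w).val = 1 := by
      intro b hb
      rw [pol_comm Q β hβ, h b (mem_filter.mp hb).2, ZMod.val_zero, pow_zero]
    rw [Finset.sum_congr rfl h1, Finset.sum_const, nsmul_eq_mul, mul_one]
  · push Not at h
    obtain ⟨v₁, hv₁, hne⟩ := h
    refine Finset.sum_involution (fun b _ => b + v₁) ?_ ?_ ?_ ?_
    · intro b _
      rw [pol_add_left Q β hβ hdeg, dnf_chi_add, pol_comm Q β hβ v₁ w, sgn_of_ne_zero hne]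
      ring
    · intro b _ _ h'
      apply hne
      have h0 : v₁ = 0 := by simpa using h'
      rw [h0, pol_comm Q β hβ, pol_zero_left Q β hβ hQ0]
    · intro b hb
      exact mem_filter.mpr ⟨mem_univ _, hpadd _ _ (mem_filter.mp hb).2 hv₁⟩
    · intro b _
      exact add_add_cancel b v₁

/-- **Gauss sum on a coset, squared.** `(∑_{u ∈ u₀ + K} (-1)^{Q u})² = |K| · ∑_{w ∈ Rad K}
(-1)^{Q (u₀ + w) + Q u₀}`, where `Rad K = {w ∈ K | β w · ≡ 0 on K}`. -/
theorem gauss_sq (hpadd : ∀ u v, p u → p v → p (u + v)) (hQ0 : Q 0 = 0)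
    (hβ : ∀ u v, β u v = Q (u + v) + Q u + Q v)
    (hdeg : ∀ u v w : Fin r → ZMod 2,
      Q (u + v + w) + Q (u + v) + Q (u + w) + Q (v + w) + Q u + Q v + Q w = 0)
    (u₀ : Fin r → ZMod 2) (f : (Fin r → ZMod 2) → Prop) [DecidablePred f]
    (hf : ∀ u, f u ↔ p (u + u₀)) :
    (∑ u ∈ univ.filter f, (-1 : ℝ) ^ (Q u).val) ^ 2 =
      ((univ.filter p).card : ℝ) *
        ∑ w ∈ univ.filter (fun w => p w ∧ ∀ v, p v → β w v = 0),
          (-1 : ℝ) ^ (Q (u₀ + w) + Q u₀).val := by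
  rw [sum_fibre p u₀ f hf, sq, Finset.sum_mul_sum, Finset.sum_comm]
  have step : ∀ b ∈ univ.filter p,
      ∑ a ∈ univ.filter p, (-1 : ℝ) ^ (Q (u₀ + a)).val * (-1 : ℝ) ^ (Q (u₀ + b)).val =
        ∑ w ∈ univ.filter p, (-1 : ℝ) ^ (Q (u₀ + w) + Q u₀).val * (-1 : ℝ) ^ (β w b).val := by
    intro b hb
    have hb' : p b := (mem_filter.mp hb).2
    rw [sum_shift p hpadd hb' (fun a => (-1 : ℝ) ^ (Q (u₀ + a)).val * (-1 : ℝ) ^ (Q (u₀ + b)).val)]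
    refine Finset.sum_congr rfl fun w _ => ?_
    rw [← dnf_chi_add, ← dnf_chi_add, gauss_identity Q β hβ hdeg u₀ b w, pol_comm Q β hβ b w]
  rw [Finset.sum_congr rfl step, Finset.sum_comm]
  simp_rw [← Finset.mul_sum]
  have inner : ∀ w ∈ univ.filter p,
      (-1 : ℝ) ^ (Q (u₀ + w) + Q u₀).val * ∑ b ∈ univ.filter p, (-1 : ℝ) ^ (β w b).val =
        if (p w ∧ ∀ v, p v → β w v = 0) then
          ((univ.filter p).card : ℝ) * (-1 : ℝ) ^ (Q (u₀ + w) + Q u₀).val else 0 := by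
    intro w hw
    have hw' : p w := (mem_filter.mp hw).2
    have hs := sum_sgn_pol p Q β hpadd hQ0 hβ hdeg w
    simp_rw [pol_comm Q β hβ _ w] at hs
    rw [hs]
    by_cases hc : ∀ v, p v → β w v = 0
    · rw [if_pos hc, if_pos ⟨hw', hc⟩, mul_comm]
    · rw [if_neg hc, if_neg (fun h => hc h.2), mul_zero]
  rw [Finset.sum_congr rfl inner, ← Finset.sum_filter, Finset.filter_filter, Finset.mul_sum]
  refine Finset.sum_congr ?_ fun w _ => rfl
  exact Finset.filter_congr (fun w _ => by tauto)

/-- `S² ≤ |K| · |Rad K|` for the Gauss sum `S` on a coset. -/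
theorem gauss_sq_le (hpadd : ∀ u v, p u → p v → p (u + v)) (hQ0 : Q 0 = 0)
    (hβ : ∀ u v, β u v = Q (u + v) + Q u + Q v)
    (hdeg : ∀ u v w : Fin r → ZMod 2,
      Q (u + v + w) + Q (u + v) + Q (u + w) + Q (v + w) + Q u + Q v + Q w = 0)
    (u₀ : Fin r → ZMod 2) (f : (Fin r → ZMod 2) → Prop) [DecidablePred f]
    (hf : ∀ u, f u ↔ p (u + u₀)) :
    (∑ u ∈ univ.filter f, (-1 : ℝ) ^ (Q u).val) ^ 2 ≤
      ((univ.filter p).card : ℝ) *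
        ((univ.filter (fun w => p w ∧ ∀ v, p v → β w v = 0)).card : ℝ) := by
  rw [gauss_sq p Q β hpadd hQ0 hβ hdeg u₀ f hf]
  gcongr
  calc ∑ w ∈ univ.filter (fun w => p w ∧ ∀ v, p v → β w v = 0),
          (-1 : ℝ) ^ (Q (u₀ + w) + Q u₀).val
        ≤ ∑ w ∈ univ.filter (fun w => p w ∧ ∀ v, p v → β w v = 0),
          |(-1 : ℝ) ^ (Q (u₀ + w) + Q u₀).val| :=
          Finset.sum_le_sum fun w _ => le_abs_self _
    _ = ((univ.filter (fun w => p w ∧ ∀ v, p v → β w v = 0)).card : ℝ) := by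
          simp only [abs_sgn, Finset.sum_const, nsmul_eq_mul, mul_one]

omit [DecidablePred p] in
/-- **Vanishing.** If some `u₁ ∈ K` has `β u₁ · ≡ 0` and `Q u₁ ≠ 0`, the Gauss sum on every
coset vanishes (pair `u ↔ u + u₁`). -/
theorem gauss_eq_zero (hpadd : ∀ u v, p u → p v → p (u + v)) (hQ0 : Q 0 = 0)
    (hβ : ∀ u v, β u v = Q (u + v) + Q u + Q v)
    (u₀ : Fin r → ZMod 2) (f : (Fin r → ZMod 2) → Prop) [DecidablePred f]
    (hf : ∀ u, f u ↔ p (u + u₀))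
    (h : ∃ u₁, p u₁ ∧ (∀ v, β u₁ v = 0) ∧ Q u₁ ≠ 0) :
    ∑ u ∈ univ.filter f, (-1 : ℝ) ^ (Q u).val = 0 := by
  obtain ⟨u₁, hp₁, hrad, hQ₁⟩ := h
  refine Finset.sum_involution (fun u _ => u + u₁) ?_ ?_ ?_ ?_
  · intro u _
    rw [eq_pol_add Q β hβ u u₁, pol_comm Q β hβ u u₁, hrad u, zero_add, dnf_chi_add,
      sgn_of_ne_zero hQ₁]
    ring
  · intro u _ _ h'
    apply hQ₁
    have h0 : u₁ = 0 := by simpa using h'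
    rw [h0, hQ0]
  · intro u hu
    have hu' : p (u + u₀) := (hf u).mp (mem_filter.mp hu).2
    refine mem_filter.mpr ⟨mem_univ _, (hf _).mpr ?_⟩
    rw [add_right_comm]
    exact hpadd _ _ hu' hp₁
  · intro u _
    exact add_add_cancel u u₁

/-- **Coset bound** (polar form as a function `β` with its defining hypothesis).
`|S| ≤ |coset| · sqrt (|Rad K| / |K|) · 1[∀ u ∈ K, β u · ≡ 0 → Q u = 0]`. -/
theorem fibre_bound_pol (hp0 : p 0) (hpadd : ∀ u v, p u → p v → p (u + v)) (hQ0 : Q 0 = 0)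
    (hβ : ∀ u v, β u v = Q (u + v) + Q u + Q v)
    (hdeg : ∀ u v w : Fin r → ZMod 2,
      Q (u + v + w) + Q (u + v) + Q (u + w) + Q (v + w) + Q u + Q v + Q w = 0)
    (u₀ : Fin r → ZMod 2) (f : (Fin r → ZMod 2) → Prop) [DecidablePred f]
    (hf : ∀ u, f u ↔ p (u + u₀)) :
    |∑ u ∈ univ.filter f, (-1 : ℝ) ^ (Q u).val| ≤
      ((univ.filter f).card : ℝ) *
        (Real.sqrt (((univ.filter (fun u => p u ∧ ∀ v, p v → β u v = 0)).card : ℝ) /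
            ((univ.filter p).card : ℝ)) *
          (if ∀ u, p u → (∀ v, β u v = 0) → Q u = 0 then 1 else 0)) := by
  split_ifs with hind
  · rw [mul_one, card_fibre p u₀ f hf]
    have hKpos : (0 : ℝ) < (univ.filter p).card := by
      exact_mod_cast Finset.card_pos.mpr ⟨0, mem_filter.mpr ⟨mem_univ _, hp0⟩⟩
    calc |∑ u ∈ univ.filter f, (-1 : ℝ) ^ (Q u).val|
        ≤ Real.sqrt (((univ.filter p).card : ℝ) *
            ((univ.filter (fun w => p w ∧ ∀ v, p v → β w v = 0)).card : ℝ)) :=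
          Real.abs_le_sqrt (gauss_sq_le p Q β hpadd hQ0 hβ hdeg u₀ f hf)
      _ = ((univ.filter p).card : ℝ) *
            Real.sqrt (((univ.filter (fun w => p w ∧ ∀ v, p v → β w v = 0)).card : ℝ) /
              ((univ.filter p).card : ℝ)) := by
          rw [← Real.sqrt_mul_self hKpos.le, ← Real.sqrt_mul (mul_self_nonneg _),
            Real.sqrt_mul_self hKpos.le]
          congr 1
          field_simp
  · rw [mul_zero, mul_zero]
    push Not at hind
    rw [gauss_eq_zero p Q β hpadd hQ0 hβ u₀ f hf hind, abs_zero]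

/-- **Coset bound**, polar form written out: for a subgroup `K = {u | p u}` of `V`, a map `Q` of
degree `≤ 2` with `Q 0 = 0`, and a coset `{u | f u} = u₀ + K`,
`|∑_{f u} (-1)^(Q u)| ≤ |{u | f u}| · sqrt (|Rad K| / |K|) · 1[∀ u ∈ K, β u · ≡ 0 → Q u = 0]`,
`β u v = Q (u + v) + Q u + Q v`, `Rad K = {u ∈ K | β u · ≡ 0 on K}`. -/
theorem fibre_bound (hp0 : p 0) (hpadd : ∀ u v, p u → p v → p (u + v)) (hQ0 : Q 0 = 0)
    (hdeg : ∀ u v w : Fin r → ZMod 2,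
      Q (u + v + w) + Q (u + v) + Q (u + w) + Q (v + w) + Q u + Q v + Q w = 0)
    (u₀ : Fin r → ZMod 2) (f : (Fin r → ZMod 2) → Prop) [DecidablePred f]
    (hf : ∀ u, f u ↔ p (u + u₀)) :
    |∑ u ∈ univ.filter f, (-1 : ℝ) ^ (Q u).val| ≤
      ((univ.filter f).card : ℝ) *
        (Real.sqrt (((univ.filter (fun u => p u ∧
              ∀ v, p v → Q (u + v) + Q u + Q v = 0)).card : ℝ) / ((univ.filter p).card : ℝ)) *
          (if ∀ u, p u → (∀ v, Q (u + v) + Q u + Q v = 0) → Q u = 0 then 1 else 0)) :=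
  fibre_bound_pol p Q (fun u v => Q (u + v) + Q u + Q v) hp0 hpadd hQ0 (fun _ _ => rfl) hdeg u₀ f hf

end Subgroup

/-- **Coset Gauss-sum bound** (registered helper sub-goal `stub_orbitGaussCoset` of the stub
`stub_orbitGauss`; closed form of `fibre_bound`): for a subgroup `K = {u | p u}` of `Fin r → ZMod 2`,
a map `Q` of degree `≤ 2` with `Q 0 = 0` and a coset `{u | f u} = u₀ + K`,
`|∑_{f u} (-1)^(Q u)| ≤ |{u | f u}| · sqrt (|Rad K| / |K|) · 1[∀ u ∈ K, β u · ≡ 0 → Q u = 0]`. -/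
theorem stub_orbitGaussCoset :
    ∀ (r : ℕ) (p : (Fin r → ZMod 2) → Prop) [DecidablePred p] (Q : (Fin r → ZMod 2) → ZMod 2) (u₀ : Fin r → ZMod 2) (f : (Fin r → ZMod 2) → Prop) [DecidablePred f], p 0 → (∀ u v, p u → p v → p (u + v)) → Q 0 = 0 → (∀ u v w, Q (u + v + w) + Q (u + v) + Q (u + w) + Q (v + w) + Q u + Q v + Q w = 0) → (∀ u, f u ↔ p (u + u₀)) → |∑ u ∈ Finset.univ.filter f, (-1 : ℝ) ^ (Q u).val| ≤ ((Finset.univ.filter f).card : ℝ) * (Real.sqrt (((Finset.univ.filter (fun u => p u ∧ ∀ v, p v → Q (u + v) + Q u + Q v = 0)).card : ℝ) / ((Finset.univ.filter p).card : ℝ)) * (if ∀ u, p u → (∀ v, Q (u + v) + Q u + Q v = 0) → Q u = 0 then 1 else 0)) := by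
  intro r p _ Q u₀ f _ hp0 hpadd hQ0 hdeg hf
  exact fibre_bound p Q hp0 hpadd hQ0 hdeg u₀ f hf

end Summit.QuantumAdvantage.QuantumAdvantage.Theorems.MobiusLadderQuadraticDigitPhasesStubOrbitGaussLemmas
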